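import Summits.QuantumFields.BalabanUV.T4Continuum.Support.NE9CurChartTower
import Literature.MathematicalPhysics.QuantumFieldTheory.Balaban1983to89.B9Eq3126H1BoundTower
import Literature.MathematicalPhysics.QuantumFieldTheory.Balaban1983to89.B11Eq118RegimeScalars

/-!
# NE9CurChartTowerUniformBall — THE CHART OF THE CURVE SPECIES `cur U` FOR PRINT'S `k`-TH-STEP OPERATOR EXISTS ON ONE AND THE SAME BALL FOR
# EVERY UNITARY SMALL FIELD `U` OF A FIXED LATTICE: `Support/NE9CurChartTower` (this lineage, gen 83) with the radii `ε₄ ε_C R_b R′` chosen BEFORE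
# `∀ U` — `Support/NE9CurChartUniformBall` (gen 81) ONE STOREY UP; cell `pub-balaban`, T4-DAG §2 node U3 ∕ §6 NE9, route R2′; BINDER row NE9 OWNER
# lineage `b2b-balaban-t4-ne9-p1`, generation 83; Summits-side NEW leaf under this seat's INTERFACE REQUEST NE9 #5 (the host leaf is at 399 l., the
# 400-line rule); nothing printed asserted

HONEST FRAMING (T4-DAG PAGE 1).  Rung (B)+1 of the FINITE-VOLUME T⁴ programme — NOT infinite volume, NOT a mass gap, NOT the Clay problem.  NE9 is a
cell NEW ESTIMATE, NOT PRINTED in [Balaban1987RG1] ∕ [Balaban1988RG2Cluster], and NOT PROVED here («NE9 ⇐ the named binders»; spine PROVED 0∕9).  HONEST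
DEPENDENCY (cell line, verbatim): continuum YM on T⁴ ⇐ BetaPertH ∧ nine spine estimates (0/9 proved); BetaPertH ⇐ (D1) ∧ (D4) ∧ CAP+tail; G-an2-4
gates asym, D1 and NE2/3/4.  The `cur U` OBJECT is ONE item of the MODEL O-NE9-1 (species (a) data); `act` ∕ `ker` and NEEDS-COORDINATOR #5 untouched.

WHY THIS FILE.  `NE9CurChartTower` §2∕§4 choose the chart's radii per background `U` (through the operator norms of `𝔊_k(U)`, `H_{1,k}(U)`).  An
analytic FAMILY in `U` — what the `ker` Cauchy core, the two-background chain and the one-instance∕END faces at `k` levels consume — needs ONE ball for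
the whole small-field set.  The uniform operator-norm bounds are this generation's `B9Eq3126H1BoundTower` ([Balaban1985BackgroundPropagators] Thm 3.11
p. 416, (3.126) p. 420, (3.153) p. 426 one storey up, read in [Balaban1985Variational] (117)'s «norm of the transformation» p. 295); `C_k(U)`'s
constants `C2T d α₀`, `ρ` are U-free (NE9 leaf-03's `B11Eq44CLetterTower.quadAnalytic_Cck`); the regimes' scalars are functions of the BOUNDS
(`B11Eq118RegimeScalars.exists_twoRegimes_radii_of_bounds`, NE9 leaf-01: [Balaban1985Variational] Prop. 6 (117)–(121), (62), (172)).

WHAT THIS FILE PROVES (0 def, 0 sorry, axioms standard).  §1 **`cur_chart_exists_tower_of_small_field_unitary_uniform`** — for every `CS ≥ 0` and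
every pair of quadratic-analyticity constants `(C₄, a₃)` of the (L3) slot there are `ε₀ > 0` and radii `ε₄, ε_C`, `R_b, R′ > 0` (finite-lattice numbers,
depending also on `k = n+1`, the level maps, `CS`) such that for EVERY background `U` of the tower's displayed data (`NE9CurChartTower` §2's binders
verbatim: per-level `U1`∕regularity at a profile `α`, unit-bounded unitary `ε`-small bond variables, right inverses `S₁`∕`S₂` of `Q′_k(1)`∕`Q′_k(U)`
bounded by `CS`, tower averaging letters `ρ′`, `δ_Q` with `ε + ρ′ + δ_Q ≤ ε₀`, `Ũ ∈ G` averaging-closed, (52) `pdev(Ũ) < α₀L^{−2(n+1)}`) and every `W`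
with `QuadAnalytic W C₄ a₃` analytic on its ball: `∃ hpos` ([Balaban1985BackgroundPropagators] Thm 3.11 for `laplaceAk`, `B9Thm311SmallFieldCoercivityTower`)
and the chart `chartHB 𝔊_k 0 W 0 (A′ ↦ A′ + solA H_{1,k} 0 C_k 0 ε_C A′) ε₄ H_{1,k}` is Fréchet-differentiable on `ball 0 R_b`, maps it into `ball 0 R′`
and fixes `0` — ON ONE BALL FOR THE WHOLE FAMILY.  §2 **`cur_chart_exists_tower_of_small_bonds_unitary_uniform`** — the `ε`-ONLY form
(`NE9CurChartTower` §4 with uniform radii): `∀ CS ≥ 0, ∀ (C₄, a₃), ∃ ε₁ ε₄ ε_C R_b R′`, for EVERY `U` with `U(b) ∈ U1`, `U(b)* = U(b)⁻¹`,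
`‖U(b) − 1‖ ≤ ε ≤ ε₁`, `Ũ ∈ G` and sections bounded by `CS`: `∃ h52 ∃ hpos` and the triple — the per-level data, `ρ′`, `δ_Q` PRODUCED as in the host
(`ulev_*_of_pdev`, `B9Eq315QTowerLipschitz`, `B7Eq43AveragedSmallness`).
DISGUISE TEST: composition by name of landed theorems; no inequality of the series proved; the radii are finite-lattice numbers, exponential in `k` —
NOT print's uniformity in the LATTICE ([Balaban1985BackgroundPropagators] Thms 3.12∕3.13), NOT the (L3) `W`, NOT the gauge step of p. 416, NOT
claimed that Bałaban's 𝐇_k meets these letters (O-NE9-1; #5 UNRULED); not NE9.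
References (TYPES ∕ loci only): [Balaban1985Variational] (45)–(47) p. 285, Prop. 6 (117)–(121) p. 295, (172)–(175) p. 305;
[Balaban1985BackgroundPropagators] (3.15)∕(3.19) p. 393, (3.26) p. 395, Thm 3.11 p. 416, (3.126) p. 420, (3.153) p. 426; [Balaban1985Averaging] Prop. 2 p. 26.
-/

noncomputable section

open Metric Set

namespace Summit.QuantumFields.BalabanUV.T4Continuum.NE9CurChartTowerUniformBall

open scoped InnerProductSpace
open Literature.MathematicalPhysics.QuantumFieldTheory.Balaban1983to89
open B11Eq103H1Complex B11Eq115Space B11Eq174Chart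
open B11Eq111FrakG (nabla115)
open B13Contraction113 (QuadAnalytic)
open B9SectCLatticeCarrier (Bond)
open B4Sect5Torus (TSite)
open B7Prop1Explicit (U1 Wcx boxVec)
open B7Prop2Explicit (pdev AvgClosed C0 c2')
open B7Prop3Flat (c3)
open B9Eq315QTorus (perCfg cornerSite)
open B9Eq315QTower (towerP UlevOf)
open B9Eq315QTowerFlat (perCfg_UlevOf_one_mem_U1 norm_Wcx_UlevOf_one_sub_one_le)
open B9Eq326OperatorTower (QprimeTowerW QkW QkW_surjective laplaceAk)
open B9Eq310HessianOperator (adTransportW)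
open B11Eq118RegimeScalars (exists_twoRegimes_radii_of_bounds)
open B11Eq44COperatorTower (C2T C2T_nonneg αT αT_le ulev_mem_U1_of_pdev ulev_reg_of_pdev)
open B11Eq44CLetterTower (Cck quadAnalytic_Cck analyticOnNhd_Cck)
open B9Thm311SmallFieldCoercivityTower (laplaceAk_pos_of_small_field_unitary)
open B9Thm311SmallFieldClosed (hRS_of_unitary)
open B9Eq3126H1BoundTower (exists_H1k_frakGk_CLM_bound_of_small_field)
open B9Eq315QTowerLipschitz (norm_QprimeTowerW_sub_flat_le norm_QkW_sub_flat_le)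
open B7Eq43AveragedSmallness (norm_UlevOf_sub_one_le pdev_le_of_bonds)
open B9Eq315QTorusOnto (liftSite perSite_liftSite)
open Summit.QuantumFields.BalabanUV.T4Continuum.NE9B11ChartAnalytic (chartHB_triple_of_twoRegimes)

/-- **§1 THE CHART OF `cur U` FOR PRINT's `k`-TH-STEP OPERATOR EXISTS ON ONE AND THE SAME BALL FOR EVERY UNITARY SMALL FIELD OF A FIXED LATTICE**
(the tower averaging letters, the sections, `G` and (52) displayed): `∀ CS ≥ 0, ∀ (C₄, a₃), ∃ ε₀ ε₄ ε_C R_b R′` BEFORE `∀ U`; `hpos` by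
`laplaceAk_pos_of_small_field_unitary`, the letters' uniform operator-norm bounds by `exists_H1k_frakGk_CLM_bound_of_small_field`, `C_k`'s U-free
constants by `quadAnalytic_Cck`, the regimes' scalars by `exists_twoRegimes_radii_of_bounds`, composition by `chartHB_triple_of_twoRegimes`. [folklore] -/
theorem cur_chart_exists_tower_of_small_field_unitary_uniform {d : ℕ} (L : ℕ) [NeZero L] (m : Fin d → ℕ) [∀ i, NeZero (m i)] (n : ℕ) (hL : 1 ≤ L)
    (hL2 : 2 ≤ L)
    {𝔸 : Type*} [NormedRing 𝔸] [NormedAlgebra ℂ 𝔸] [CompleteSpace 𝔸] [NormOneClass 𝔸] [StarRing 𝔸] [NormedStarGroup 𝔸] [StarModule ℂ 𝔸]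
    [FiniteDimensional ℂ 𝔸]
    {W : Type*} [NormedAddCommGroup W] [InnerProductSpace ℂ W] [FiniteDimensional ℂ W] (φ : W ≃ₗ[ℂ] 𝔸) {Mφ Mφ' : ℝ} (hMφ : 0 ≤ Mφ)
    (hMφ' : 0 ≤ Mφ') (hφ : ∀ w, ‖φ w‖ ≤ Mφ * ‖w‖) (hφ' : ∀ X, ‖φ.symm X‖ ≤ Mφ' * ‖X‖)
    (τ : 𝔸 →ₗ[ℂ] ℂ) {Cτ : ℝ} (hτ : ∀ X, ‖τ X‖ ≤ Cτ * ‖X‖) (hCτ : 0 ≤ Cτ)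
    (hτφ : ∀ X Y : 𝔸, inner ℂ (φ.symm X) (φ.symm Y) = τ (star X * Y)) (htr : ∀ X Y : 𝔸, τ (X * Y) = τ (Y * X))
    {η : ℝ} (hη : η ≠ 0) [Fact (0 < (L : ℝ))] [Fact (0 < η)] {lev₀ : Bond d (towerP L m (n + 1)) → ℕ} {levB : Bond d m → ℕ}
    (lev₁ : Bond d (towerP L m (n + 1)) × Fin d → ℕ) (α : ℕ → ℝ) (hα1 : ∀ j, α j ≤ 1 / 64) (hαL : ∀ j, 50 * (d + 1) * α j * (L : ℝ) ^ d ≤ 1 / 2)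
    {G : Subgroup 𝔸ˣ} (hG : AvgClosed d L G) {α₀ : ℝ} (hα₀ : 0 < α₀) (hα3 : C0 d * α₀ ≤ 1 / 3) (hα4 : 4 * α₀ ≤ c2' d L) (hlev : ∀ b, n + 1 ≤ lev₀ b)
    {ρ : ℝ} (hρ0 : 0 < ρ) (hρ : Real.exp (4 * (800 * ((d : ℝ) + 1) ^ 2 * ((d : ℝ) + 4)) * α₀) * (1 + 8 * (131072 * ((d : ℝ) + 1) ^ 2) * ρ) ≤ 2)
    (hρc : 2 * ρ ≤ c3 d L) {c₀ c₁ : ℝ} [Fact (0 < c₀)] [Fact (0 < c₁)] {a : ℝ} (ha : 0 < a) {CS : ℝ} (hCS : 0 ≤ CS)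
    {C₄ a₃ : ℝ} (hC₄ : 0 ≤ C₄) (ha₃ : 0 < a₃) :
    ∃ ε₀ ε₄ εC Rb R' : ℝ, 0 < ε₀ ∧ 0 < Rb ∧ 0 < R' ∧ ∀ (U : Bond d (towerP L m (n + 1)) → 𝔸ˣ)
      (hU1 : ∀ (j : ℕ) (x : B7Prop1Explicit.Site d) (κ : Fin d), perCfg (towerP L m (j + 1)) (UlevOf L m (n + 1) U j) x κ ∈ U1 𝔸)
      (hreg : ∀ (j : ℕ) (y : TSite d (towerP L m j)) (κ : Fin d) (r : Fin d → Fin L),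
        ‖((Wcx L (perCfg (towerP L m (j + 1)) (UlevOf L m (n + 1) U j)) (cornerSite L y) κ (boxVec L r) : 𝔸ˣ) : 𝔸) - 1‖ ≤ α j)
      (S₁ S₂ : (TSite d m → W) →ₗ[ℂ] SiteL2K ℂ d (towerP L m (n + 1)) c₀ W)
      {ε ρ' δQ : ℝ}, 0 ≤ ε → 0 ≤ ρ' → 0 ≤ δQ → ε + ρ' + δQ ≤ ε₀ →
      (∀ b, U b ∈ U1 𝔸) → (∀ b, ‖(U b : 𝔸) - 1‖ ≤ ε) → (∀ b, star (U b : 𝔸) = (((U b)⁻¹ : 𝔸ˣ) : 𝔸)) →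
      (∀ f, QprimeTowerW L m n φ (fun _ : Bond d (towerP L m (n + 1)) => (1 : 𝔸ˣ)) (S₁ f) = f) →
      (∀ f, QprimeTowerW L m n φ U (S₂ f) = f) → (∀ f, ‖S₁ f‖ ≤ CS * ‖f‖) → (∀ f, ‖S₂ f‖ ≤ CS * ‖f‖) →
      (∀ l : SiteL2K ℂ d (towerP L m (n + 1)) c₀ W,
        ‖QprimeTowerW L m n φ U l - QprimeTowerW L m n φ (fun _ : Bond d (towerP L m (n + 1)) => (1 : 𝔸ˣ)) l‖ ≤ ρ' * ‖l‖) →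
      (∀ x : BondL2K ℂ d (towerP L m (n + 1)) c₀ W, ‖QkW L m n φ U hL α hα1 hU1 hreg (c₁ := c₁) x -
        QkW L m n φ (fun _ : Bond d (towerP L m (n + 1)) => (1 : 𝔸ˣ)) hL (fun _ => 0) (fun _ => by norm_num)
          (perCfg_UlevOf_one_mem_U1 L m (n + 1)) (norm_Wcx_UlevOf_one_sub_one_le L m (n + 1) (fun _ => 0) (fun _ => le_rfl)) (c₁ := c₁) x‖ ≤
        δQ * ‖x‖) →
      (∀ (x : B7Prop1Explicit.Site d) (κ : Fin d), perCfg (towerP L m (n + 1)) U x κ ∈ G) →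
      pdev (perCfg (towerP L m (n + 1)) U) < α₀ * (((L : ℝ) ^ (n + 1))⁻¹) ^ 2 →
      ∀ {Wq : Space115 (L : ℝ) η lev₀ lev₁ (nabla115 η U) → NegSize (L : ℝ) η lev₀ 3 𝔸}, QuadAnalytic Wq C₄ a₃ →
        AnalyticOnNhd ℂ Wq {Y | ‖Y‖ < a₃} →
      ∃ hpos : ∀ x : BondL2K ℂ d (towerP L m (n + 1)) c₀ W, x ≠ 0 →
          0 < RCLike.re (inner ℂ x (laplaceAk L m n φ η U hL α hα1 hU1 hreg τ (c₀ := c₀) (c₁ := c₁) a x)),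
        DifferentiableOn ℂ (chartHB (frakGLatticeCLM (lev₀ := lev₀) φ hpos (QkW_surjective L m n φ U hL α hα1 hU1 hreg hαL) lev₁ (nabla115 η U))
            0 Wq 0 (fun A' => A' + solA (H1LatticeCLM (lev₀ := lev₀) (levB := levB) φ hpos (QkW_surjective L m n φ U hL α hα1 hU1 hreg hαL) lev₁
              (nabla115 η U)) 0 (Cck L m η (n + 1) U lev₀ lev₁ (nabla115 η U) levB) 0 εC A') ε₄
            (H1LatticeCLM (lev₀ := lev₀) (levB := levB) φ hpos (QkW_surjective L m n φ U hL α hα1 hU1 hreg hαL) lev₁ (nabla115 η U)))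
          (ball (0 : NegSize (L : ℝ) η levB 0 𝔸) Rb) ∧
        MapsTo (chartHB (frakGLatticeCLM (lev₀ := lev₀) φ hpos (QkW_surjective L m n φ U hL α hα1 hU1 hreg hαL) lev₁ (nabla115 η U))
            0 Wq 0 (fun A' => A' + solA (H1LatticeCLM (lev₀ := lev₀) (levB := levB) φ hpos (QkW_surjective L m n φ U hL α hα1 hU1 hreg hαL) lev₁
              (nabla115 η U)) 0 (Cck L m η (n + 1) U lev₀ lev₁ (nabla115 η U) levB) 0 εC A') ε₄
            (H1LatticeCLM (lev₀ := lev₀) (levB := levB) φ hpos (QkW_surjective L m n φ U hL α hα1 hU1 hreg hαL) lev₁ (nabla115 η U)))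
          (ball (0 : NegSize (L : ℝ) η levB 0 𝔸) Rb) (ball (0 : Space115 (L : ℝ) η lev₀ lev₁ (nabla115 η U)) R') ∧
        chartHB (frakGLatticeCLM (lev₀ := lev₀) φ hpos (QkW_surjective L m n φ U hL α hα1 hU1 hreg hαL) lev₁ (nabla115 η U))
            0 Wq 0 (fun A' => A' + solA (H1LatticeCLM (lev₀ := lev₀) (levB := levB) φ hpos (QkW_surjective L m n φ U hL α hα1 hU1 hreg hαL) lev₁
              (nabla115 η U)) 0 (Cck L m η (n + 1) U lev₀ lev₁ (nabla115 η U) levB) 0 εC A') ε₄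
            (H1LatticeCLM (lev₀ := lev₀) (levB := levB) φ hpos (QkW_surjective L m n φ U hL α hα1 hU1 hreg hαL) lev₁ (nabla115 η U)) 0 = 0 := by
  -- Thm 3.11 one storey up at every small field (INTENT-3) and the uniform bounds of the chart letters in the chart's type (INTENT-7 §4)
  obtain ⟨ε₀, hε₀, Hpos⟩ := laplaceAk_pos_of_small_field_unitary L m n hL φ (c₀ := c₀) (c₁ := c₁) α hα1 hη ha hMφ hMφ' hφ hφ' τ hτ hCτ hτφ
    htr hCS
  obtain ⟨CH, CG, ε₅, hCH, hCG, hε₅, Hb⟩ := exists_H1k_frakGk_CLM_bound_of_small_field L m n hL φ (c₀ := c₀) (c₁ := c₁) α hα1 (η := η) lev₀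
    levB lev₁ ha hMφ hMφ' hφ hφ' τ hτ hCτ hCS
  -- the scalar letters of the two regimes from the BOUNDS (`C_k(U)`'s constants `C2T d α₀`, `ρ` are U-free)
  obtain ⟨j, a', ε₄, aC, εC, R', Rb, hj, ha', -, -, -, hR'0, hRb0, hcap, hR'le, Hreg⟩ :=
    exists_twoRegimes_radii_of_bounds (B₀ := CG) (b := CH) (b₁ := CH) (C₄ := C₄) (a₃ := a₃) (C₂ := C2T d α₀) (c₄ := ρ) hCG.le hCH.le hCH.le
      hC₄ ha₃ (C2T_nonneg d α₀) hρ0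
  refine ⟨min ε₀ ε₅, ε₄, εC, Rb, R', lt_min hε₀ hε₅, hRb0, hR'0, ?_⟩
  intro U hU1 hreg S₁ S₂ ε ρ' δQ hε hρ' hδQ ht hUb hUε hUstar hS₁ hS₂ hS₁n hS₂n hQ' hQd hUG h52 Wq hW hWa
  have hpos := Hpos U hU1 hreg S₁ S₂ hε hρ' hδQ (ht.trans (min_le_left _ _)) hUb hUε hUstar hS₁ hS₂ hS₁n hS₂n hQ' hQd
  refine ⟨hpos, ?_⟩
  obtain ⟨hHb, hGb⟩ := Hb U hU1 hreg S₁ S₂ hε hρ' hδQ (ht.trans (min_le_right _ _)) hUb hUε (hRS_of_unitary φ τ hτφ htr U hUstar) hS₁ hS₂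
    hS₁n hS₂n hQ' hQd hpos (QkW_surjective L m n φ U hL α hα1 hU1 hreg hαL)
  have hC := quadAnalytic_Cck L m η (n + 1) U lev₀ lev₁ (nabla115 η U) levB hL2 hG hUG hα₀ hα3 hα4 h52 hlev hρ hρc
  have hCa := analyticOnNhd_Cck L m η (n + 1) U lev₀ lev₁ (nabla115 η U) levB hL2 hG hUG hα₀ hα3 hα4 h52 hlev hρ hρc
  have hHpt : ∀ B : NegSize (L : ℝ) η levB 0 𝔸,
      ‖H1LatticeCLM (lev₀ := lev₀) (levB := levB) φ hpos (QkW_surjective L m n φ U hL α hα1 hU1 hreg hαL) lev₁ (nabla115 η U) B‖ ≤ CH * ‖B‖ :=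
    fun B => (ContinuousLinearMap.le_opNorm _ B).trans (mul_le_mul_of_nonneg_right hHb (norm_nonneg B))
  have hGpt : ∀ f : NegSize (L : ℝ) η lev₀ 3 𝔸,
      ‖frakGLatticeCLM (lev₀ := lev₀) φ hpos (QkW_surjective L m n φ U hL α hα1 hU1 hreg hαL) lev₁ (nabla115 η U) f‖ ≤ CG * ‖f‖ :=
    fun f => (ContinuousLinearMap.le_opNorm _ f).trans (mul_le_mul_of_nonneg_right hGb (norm_nonneg f))
  obtain ⟨R, RC, hRb⟩ := Hreg (frakGLatticeCLM (lev₀ := lev₀) φ hpos (QkW_surjective L m n φ U hL α hα1 hU1 hreg hαL) lev₁ (nabla115 η U)) Wq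
    (H1LatticeCLM (lev₀ := lev₀) (levB := levB) φ hpos (QkW_surjective L m n φ U hL α hα1 hU1 hreg hαL) lev₁ (nabla115 η U))
    (Cck L m η (n + 1) U lev₀ lev₁ (nabla115 η U) levB)
    (H1LatticeCLM (lev₀ := lev₀) (levB := levB) φ hpos (QkW_surjective L m n φ U hL α hα1 hU1 hreg hαL) lev₁ (nabla115 η U)) hGpt hW hHpt hC hHpt
  exact chartHB_triple_of_twoRegimes R hWa hj.le ha' RC hCa hcap _ hRb hR'0 hR'le

/-- The linear majorant `(1 + ε)^n − 1 ≤ n·ε·(1 + ε)^n` for `ε ≥ 0` (private arithmetic helper, as in the host leaf). [folklore] -/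
private theorem pow_sub_one_le_mul_k {ε : ℝ} (hε : 0 ≤ ε) : ∀ n : ℕ, (1 + ε) ^ n - 1 ≤ n * ε * (1 + ε) ^ n
  | 0 => by simp
  | n + 1 => by
    have ih := pow_sub_one_le_mul_k hε n
    have h1 : (1 : ℝ) ≤ (1 + ε) ^ n := one_le_pow₀ (by linarith)
    rw [pow_succ, Nat.cast_succ]
    have h3 : 0 ≤ ((n : ℝ) + 1) * ε * (1 + ε) ^ n := by positivity
    calc (1 + ε) ^ n * (1 + ε) - 1 = ((1 + ε) ^ n - 1) + ε * (1 + ε) ^ n := by ring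
      _ ≤ (n : ℝ) * ε * (1 + ε) ^ n + ε * (1 + ε) ^ n := by gcongr
      _ = ((n : ℝ) + 1) * ε * (1 + ε) ^ n := by ring
      _ ≤ ((n : ℝ) + 1) * ε * (1 + ε) ^ n * (1 + ε) := le_mul_of_one_le_right h3 (by linarith)
      _ = ((n : ℝ) + 1) * ε * ((1 + ε) ^ n * (1 + ε)) := by ring

/-- **§2 THE `ε`-ONLY FORM ON ONE BALL** — §1 at [Balaban1985Averaging] Prop. 2's data with the per-level displays, `ρ′`, `δ_Q` and (52) PRODUCED from
`‖U(b) − 1‖ ≤ ε ≤ ε₁` exactly as in the host's §4 (`ulev_mem_U1_of_pdev` ∕ `ulev_reg_of_pdev`, `norm_QprimeTowerW_sub_flat_le` ∕ `norm_QkW_sub_flat_le`,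
`norm_UlevOf_sub_one_le`, `pdev_le_of_bonds`): `∀ CS ≥ 0, ∀ (C₄, a₃), ∃ ε₁ ε₄ ε_C R_b R′`, for EVERY such `U`: `∃ h52 ∃ hpos` and the triple (Ψ1)–(Ψ3).
Displayed background letters left: `ε`, the gauge group `G` (averaging-closed) with `C_k`'s numerics `α₀`∕`ρ`, the sections. [folklore] -/
theorem cur_chart_exists_tower_of_small_bonds_unitary_uniform {d : ℕ} (L : ℕ) [NeZero L] (m : Fin d → ℕ) [∀ i, NeZero (m i)] (n : ℕ) (hL : 1 ≤ L)
    (hL2 : 2 ≤ L)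
    {𝔸 : Type*} [NormedRing 𝔸] [NormedAlgebra ℂ 𝔸] [CompleteSpace 𝔸] [NormOneClass 𝔸] [StarRing 𝔸] [NormedStarGroup 𝔸] [StarModule ℂ 𝔸]
    [FiniteDimensional ℂ 𝔸]
    {W : Type*} [NormedAddCommGroup W] [InnerProductSpace ℂ W] [FiniteDimensional ℂ W] (φ : W ≃ₗ[ℂ] 𝔸) {Mφ Mφ' : ℝ} (hMφ : 0 ≤ Mφ)
    (hMφ' : 0 ≤ Mφ') (hφ : ∀ w, ‖φ w‖ ≤ Mφ * ‖w‖) (hφ' : ∀ X, ‖φ.symm X‖ ≤ Mφ' * ‖X‖)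
    (τ : 𝔸 →ₗ[ℂ] ℂ) {Cτ : ℝ} (hτ : ∀ X, ‖τ X‖ ≤ Cτ * ‖X‖) (hCτ : 0 ≤ Cτ)
    (hτφ : ∀ X Y : 𝔸, inner ℂ (φ.symm X) (φ.symm Y) = τ (star X * Y)) (htr : ∀ X Y : 𝔸, τ (X * Y) = τ (Y * X))
    {η : ℝ} (hη : η ≠ 0) [Fact (0 < (L : ℝ))] [Fact (0 < η)] {lev₀ : Bond d (towerP L m (n + 1)) → ℕ} {levB : Bond d m → ℕ}
    (lev₁ : Bond d (towerP L m (n + 1)) × Fin d → ℕ)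
    {G : Subgroup 𝔸ˣ} (hG : AvgClosed d L G) {α₀ : ℝ} (hα₀ : 0 < α₀) (hα3 : C0 d * α₀ ≤ 1 / 3) (hα4 : 4 * α₀ ≤ c2' d L)
    (hαL : 50 * (d + 1) * αT d L α₀ * (L : ℝ) ^ d ≤ 1 / 2) (hlev : ∀ b, n + 1 ≤ lev₀ b)
    {ρ : ℝ} (hρ0 : 0 < ρ) (hρ : Real.exp (4 * (800 * ((d : ℝ) + 1) ^ 2 * ((d : ℝ) + 4)) * α₀) * (1 + 8 * (131072 * ((d : ℝ) + 1) ^ 2) * ρ) ≤ 2)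
    (hρc : 2 * ρ ≤ c3 d L) {c₀ c₁ : ℝ} [Fact (0 < c₀)] [Fact (0 < c₁)] {a : ℝ} (ha : 0 < a) {CS : ℝ} (hCS : 0 ≤ CS)
    {C₄ a₃ : ℝ} (hC₄ : 0 ≤ C₄) (ha₃ : 0 < a₃) :
    ∃ ε₁ ε₄ εC Rb R' : ℝ, 0 < ε₁ ∧ 0 < Rb ∧ 0 < R' ∧ ∀ (U : Bond d (towerP L m (n + 1)) → 𝔸ˣ)
      (hUG : ∀ (x : B7Prop1Explicit.Site d) (κ : Fin d), perCfg (towerP L m (n + 1)) U x κ ∈ G)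
      (S₁ S₂ : (TSite d m → W) →ₗ[ℂ] SiteL2K ℂ d (towerP L m (n + 1)) c₀ W)
      {ε : ℝ}, 0 ≤ ε → ε ≤ ε₁ →
      (∀ b, U b ∈ U1 𝔸) → (∀ b, ‖(U b : 𝔸) - 1‖ ≤ ε) → (∀ b, star (U b : 𝔸) = (((U b)⁻¹ : 𝔸ˣ) : 𝔸)) →
      (∀ f, QprimeTowerW L m n φ (fun _ : Bond d (towerP L m (n + 1)) => (1 : 𝔸ˣ)) (S₁ f) = f) →
      (∀ f, QprimeTowerW L m n φ U (S₂ f) = f) → (∀ f, ‖S₁ f‖ ≤ CS * ‖f‖) → (∀ f, ‖S₂ f‖ ≤ CS * ‖f‖) →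
      ∀ {Wq : Space115 (L : ℝ) η lev₀ lev₁ (nabla115 η U) → NegSize (L : ℝ) η lev₀ 3 𝔸}, QuadAnalytic Wq C₄ a₃ →
        AnalyticOnNhd ℂ Wq {Y | ‖Y‖ < a₃} →
      ∃ h52 : pdev (perCfg (towerP L m (n + 1)) U) < α₀ * (((L : ℝ) ^ (n + 1))⁻¹) ^ 2,
      ∃ hpos : ∀ x : BondL2K ℂ d (towerP L m (n + 1)) c₀ W, x ≠ 0 →
          0 < RCLike.re (inner ℂ x (laplaceAk L m n φ η U hL (fun _ => αT d L α₀) (fun _ => αT_le hL hα4)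
            (ulev_mem_U1_of_pdev L m (n + 1) U hL2 hG hUG hα₀ hα3 hα4 h52) (ulev_reg_of_pdev L m (n + 1) U hL2 hG hUG hα₀ hα3 hα4 h52) τ
            (c₀ := c₀) (c₁ := c₁) a x)),
        DifferentiableOn ℂ (chartHB (frakGLatticeCLM (lev₀ := lev₀) φ hpos (QkW_surjective L m n φ U hL _ _ _ _ fun _ => hαL) lev₁ (nabla115 η U))
            0 Wq 0 (fun A' => A' + solA (H1LatticeCLM (lev₀ := lev₀) (levB := levB) φ hpos (QkW_surjective L m n φ U hL _ _ _ _ fun _ => hαL) lev₁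
              (nabla115 η U)) 0 (Cck L m η (n + 1) U lev₀ lev₁ (nabla115 η U) levB) 0 εC A') ε₄
            (H1LatticeCLM (lev₀ := lev₀) (levB := levB) φ hpos (QkW_surjective L m n φ U hL _ _ _ _ fun _ => hαL) lev₁ (nabla115 η U)))
          (ball (0 : NegSize (L : ℝ) η levB 0 𝔸) Rb) ∧
        MapsTo (chartHB (frakGLatticeCLM (lev₀ := lev₀) φ hpos (QkW_surjective L m n φ U hL _ _ _ _ fun _ => hαL) lev₁ (nabla115 η U))
            0 Wq 0 (fun A' => A' + solA (H1LatticeCLM (lev₀ := lev₀) (levB := levB) φ hpos (QkW_surjective L m n φ U hL _ _ _ _ fun _ => hαL) lev₁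
              (nabla115 η U)) 0 (Cck L m η (n + 1) U lev₀ lev₁ (nabla115 η U) levB) 0 εC A') ε₄
            (H1LatticeCLM (lev₀ := lev₀) (levB := levB) φ hpos (QkW_surjective L m n φ U hL _ _ _ _ fun _ => hαL) lev₁ (nabla115 η U)))
          (ball (0 : NegSize (L : ℝ) η levB 0 𝔸) Rb) (ball (0 : Space115 (L : ℝ) η lev₀ lev₁ (nabla115 η U)) R') ∧
        chartHB (frakGLatticeCLM (lev₀ := lev₀) φ hpos (QkW_surjective L m n φ U hL _ _ _ _ fun _ => hαL) lev₁ (nabla115 η U))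
            0 Wq 0 (fun A' => A' + solA (H1LatticeCLM (lev₀ := lev₀) (levB := levB) φ hpos (QkW_surjective L m n φ U hL _ _ _ _ fun _ => hαL) lev₁
              (nabla115 η U)) 0 (Cck L m η (n + 1) U lev₀ lev₁ (nabla115 η U) levB) 0 εC A') ε₄
            (H1LatticeCLM (lev₀ := lev₀) (levB := levB) φ hpos (QkW_surjective L m n φ U hL _ _ _ _ fun _ => hαL) lev₁ (nabla115 η U)) 0 = 0 := by
  have hc₀ : 0 < c₀ := Fact.out
  have hL1 : (1 : ℝ) ≤ L := by exact_mod_cast hL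
  have hd : (0 : ℝ) ≤ d := Nat.cast_nonneg d
  obtain ⟨ε₀, ε₄, εC, Rb, R', hε₀, hRb0, hR'0, H⟩ := cur_chart_exists_tower_of_small_field_unitary_uniform L m n hL hL2 φ (c₀ := c₀) (c₁ := c₁)
    (lev₀ := lev₀) (levB := levB) hMφ hMφ' hφ hφ' τ hτ hCτ hτφ htr hη lev₁ (fun _ => αT d L α₀) (fun _ => αT_le hL hα4) (fun _ => hαL) hG hα₀ hα3
    hα4 hlev hρ0 hρ hρc ha hCS hC₄ ha₃
  -- the constants of the produced letters: `ε̄ = Cᵏε`, `ρ′ ≤ Kρ·ε` (for `2M_φM_φ′ε̄ ≤ 1`), `δ_Q = KQ·ε`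
  obtain ⟨Ck, hCkdef⟩ : ∃ Ck : ℝ, Ck = (8 * ((d : ℝ) + 1) * L) ^ (n + 1) := ⟨_, rfl⟩
  have hCk1 : 1 ≤ Ck := by rw [hCkdef]; exact one_le_pow₀ (by nlinarith)
  have hCk0 : 0 < Ck := lt_of_lt_of_le one_pos hCk1
  obtain ⟨Kρ, hKρdef⟩ : ∃ Kρ : ℝ, Kρ = ((d * (L - 1) * (n + 1) : ℕ) : ℝ) * (2 * Mφ * Mφ' * Ck) * 2 ^ (d * (L - 1) * (n + 1)) * (Real.sqrt c₀)⁻¹ :=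
    ⟨_, rfl⟩
  have hKρ : 0 ≤ Kρ := by rw [hKρdef]; positivity
  obtain ⟨KQ, hKQdef⟩ : ∃ KQ : ℝ, KQ = Mφ' * Mφ * Real.sqrt (c₁ * Fintype.card (Bond d m) / c₀) * ((2 ^ (n + 1) - 1) * (102 * (d + 1) ^ 2 * L * Ck)) :=
    ⟨_, rfl⟩
  have h2n : (0 : ℝ) ≤ 2 ^ (n + 1) - 1 := sub_nonneg.2 (one_le_pow₀ (by norm_num))
  have hKQ : 0 ≤ KQ := by rw [hKQdef]; positivity
  have hX0 : 0 < α₀ * (((L : ℝ) ^ (n + 1))⁻¹) ^ 2 := by positivity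
  refine ⟨min (min (ε₀ / (1 + Kρ + KQ)) (α₀ * (((L : ℝ) ^ (n + 1))⁻¹) ^ 2 / 8)) (min (1 / (2 * Mφ * Mφ' * Ck + 1)) (1 / (32 * Ck))),
    ε₄, εC, Rb, R', by positivity, hRb0, hR'0, ?_⟩
  intro U hUG S₁ S₂ ε hε hε₁ hUb hUε hUstar hS₁ hS₂ hS₁n hS₂n Wq hW hWa
  have hε₁a : ε ≤ ε₀ / (1 + Kρ + KQ) := hε₁.trans ((min_le_left _ _).trans (min_le_left _ _))
  have hε₁d : ε ≤ α₀ * (((L : ℝ) ^ (n + 1))⁻¹) ^ 2 / 8 := hε₁.trans ((min_le_left _ _).trans (min_le_right _ _))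
  have hε₁b : ε ≤ 1 / (2 * Mφ * Mφ' * Ck + 1) := hε₁.trans ((min_le_right _ _).trans (min_le_left _ _))
  have hε₁c : ε ≤ 1 / (32 * Ck) := hε₁.trans ((min_le_right _ _).trans (min_le_right _ _))
  -- (52) from the bonds: `pdev(Ũ) ≤ 4ε < α₀L^{−2(n+1)}`
  have h52 : pdev (perCfg (towerP L m (n + 1)) U) < α₀ * (((L : ℝ) ^ (n + 1))⁻¹) ^ 2 := by
    have hp := pdev_le_of_bonds (V := perCfg (towerP L m (n + 1)) U) (fun x κ => by rw [B9Eq315QTorus.perCfg_apply]; exact hUb _) hε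
      (fun x κ => by rw [B9Eq315QTorus.perCfg_apply]; exact hUε _)
    linarith
  -- the level averages: `ε̄`-small (INTENT-6) and in `U1` (leaf-03's Prop. 2 reading)
  have hs : (8 * ((d : ℝ) + 1) * L) ^ (n + 1) * ε ≤ 1 / 32 := by
    rw [← hCkdef]
    have := (mul_le_mul_of_nonneg_left hε₁c hCk0.le)
    rwa [mul_one_div, mul_comm 32 Ck, ← div_div, div_self hCk0.ne'] at this
  have hUε' : ∀ (j : ℕ) (b : Bond d (towerP L m (j + 1))), ‖(UlevOf L m (n + 1) U j b : 𝔸) - 1‖ ≤ Ck * ε := fun j b => by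
    rw [hCkdef]; exact norm_UlevOf_sub_one_le L hL m (n + 1) U hε hUε hs j b
  have hUb' : ∀ (j : ℕ) (b : Bond d (towerP L m (j + 1))), UlevOf L m (n + 1) U j b ∈ U1 𝔸 := fun j b => by
    have h := ulev_mem_U1_of_pdev L m (n + 1) U hL2 hG hUG hα₀ hα3 hα4 h52 j (liftSite b.1) b.2
    rwa [B9Eq315QTorus.perCfg_apply, perSite_liftSite] at h
  have hαT0 : 0 ≤ αT d L α₀ := by unfold αT; positivity
  have hα2 : ∀ j : ℕ, 50 * ((d : ℝ) + 1) * αT d L α₀ ≤ 1 := fun _ => by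
    have hLd : (1 : ℝ) ≤ (L : ℝ) ^ d := one_le_pow₀ hL1
    have : 50 * ((d : ℝ) + 1) * αT d L α₀ ≤ 50 * ((d : ℝ) + 1) * αT d L α₀ * (L : ℝ) ^ d := le_mul_of_one_le_right (by positivity) hLd
    linarith
  have hCkε : 0 ≤ Ck * ε := by positivity
  -- (ρ′) produced
  have hρ' : ∀ l : SiteL2K ℂ d (towerP L m (n + 1)) c₀ W,
      ‖QprimeTowerW L m n φ U l - QprimeTowerW L m n φ (fun _ : Bond d (towerP L m (n + 1)) => (1 : 𝔸ˣ)) l‖ ≤ Kρ * ε * ‖l‖ := fun l => by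
    have h := norm_QprimeTowerW_sub_flat_le L m n (c₀ := c₀) φ hMφ hMφ' hφ hφ' U hCkε hUε' hUb' l
    refine h.trans ?_
    rw [← mul_assoc]
    refine mul_le_mul_of_nonneg_right ?_ (norm_nonneg _)
    -- `(1+x)^N − 1 ≤ N x (1+x)^N ≤ N x 2^N` for `x = 2M_φM_φ′Cᵏε ≤ 1`
    have hx0 : 0 ≤ 2 * Mφ * Mφ' * (Ck * ε) := by positivity
    have hx1 : 2 * Mφ * Mφ' * (Ck * ε) ≤ 1 := by
      have h1 := mul_le_mul_of_nonneg_left hε₁b (by positivity : (0 : ℝ) ≤ 2 * Mφ * Mφ' * Ck)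
      have hfrac : 2 * Mφ * Mφ' * Ck * (1 / (2 * Mφ * Mφ' * Ck + 1)) ≤ 1 := by
        rw [mul_one_div, div_le_one (by positivity)]; linarith
      have hass : 2 * Mφ * Mφ' * (Ck * ε) = 2 * Mφ * Mφ' * Ck * ε := by ring
      rw [hass]; exact h1.trans hfrac
    have hpow := pow_sub_one_le_mul_k hx0 (d * (L - 1) * (n + 1))
    have h2N : (1 + 2 * Mφ * Mφ' * (Ck * ε)) ^ (d * (L - 1) * (n + 1)) ≤ 2 ^ (d * (L - 1) * (n + 1)) :=
      pow_le_pow_left₀ (by positivity) (by linarith) _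
    rw [← pow_mul]
    calc ((1 + 2 * Mφ * Mφ' * (Ck * ε)) ^ (d * (L - 1) * (n + 1)) - 1) * (Real.sqrt c₀)⁻¹
        ≤ (((d * (L - 1) * (n + 1) : ℕ) : ℝ) * (2 * Mφ * Mφ' * (Ck * ε)) * (1 + 2 * Mφ * Mφ' * (Ck * ε)) ^ (d * (L - 1) * (n + 1))) * (Real.sqrt c₀)⁻¹ :=
          mul_le_mul_of_nonneg_right hpow (by positivity)
      _ ≤ (((d * (L - 1) * (n + 1) : ℕ) : ℝ) * (2 * Mφ * Mφ' * (Ck * ε)) * 2 ^ (d * (L - 1) * (n + 1))) * (Real.sqrt c₀)⁻¹ :=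
          mul_le_mul_of_nonneg_right (mul_le_mul_of_nonneg_left h2N (by positivity)) (by positivity)
      _ = Kρ * ε := by rw [hKρdef]; ring
  -- (δ_Q) produced
  have hδQ : ∀ x : BondL2K ℂ d (towerP L m (n + 1)) c₀ W,
      ‖QkW L m n φ U hL (fun _ => αT d L α₀) (fun _ => αT_le hL hα4) (ulev_mem_U1_of_pdev L m (n + 1) U hL2 hG hUG hα₀ hα3 hα4 h52)
            (ulev_reg_of_pdev L m (n + 1) U hL2 hG hUG hα₀ hα3 hα4 h52) (c₁ := c₁) x -
          QkW L m n φ (fun _ : Bond d (towerP L m (n + 1)) => (1 : 𝔸ˣ)) hL (fun _ => 0) (fun _ => by norm_num)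
            (perCfg_UlevOf_one_mem_U1 L m (n + 1)) (norm_Wcx_UlevOf_one_sub_one_le L m (n + 1) (fun _ => 0) (fun _ => le_rfl)) (c₁ := c₁) x‖ ≤
        KQ * ε * ‖x‖ := fun x => by
    have h := norm_QkW_sub_flat_le L m n hL φ hMφ hMφ' hφ hφ' (c₀ := c₀) (c₁ := c₁) U (fun _ => αT d L α₀) (fun _ => αT_le hL hα4)
      (ulev_mem_U1_of_pdev L m (n + 1) U hL2 hG hUG hα₀ hα3 hα4 h52) (ulev_reg_of_pdev L m (n + 1) U hL2 hG hUG hα₀ hα3 hα4 h52) hα2 hCkε hUε' x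
    refine h.trans (le_of_eq ?_)
    rw [hKQdef]; ring
  -- the budget `ε + ρ′ + δ_Q ≤ ε₀`
  have hbudget : ε + Kρ * ε + KQ * ε ≤ ε₀ := by
    have h1 : ε + Kρ * ε + KQ * ε = ε * (1 + Kρ + KQ) := by ring
    have h2 : ε * (1 + Kρ + KQ) ≤ ε₀ := by
      have := mul_le_mul_of_nonneg_right hε₁a (by positivity : (0 : ℝ) ≤ 1 + Kρ + KQ)
      rwa [div_mul_cancel₀ _ (by positivity : (1 + Kρ + KQ) ≠ 0)] at this
    rw [h1]; exact h2
  exact ⟨h52, H U (ulev_mem_U1_of_pdev L m (n + 1) U hL2 hG hUG hα₀ hα3 hα4 h52) (ulev_reg_of_pdev L m (n + 1) U hL2 hG hUG hα₀ hα3 hα4 h52)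
    S₁ S₂ hε (by positivity) (by positivity) hbudget hUb hUε hUstar hS₁ hS₂ hS₁n hS₂n hρ' hδQ hUG h52 hW hWa⟩

end Summit.QuantumFields.BalabanUV.T4Continuum.NE9CurChartTowerUniformBall

end
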